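import Summits.Ventures.PercRepro.FaceCodes
import Summits.Ventures.PercRepro.Multi
import Summits.Ventures.PercRepro.Isolated

/-!
# A census of simple graphs on six vertices up to isomorphism, in the kernel

A simple graph `G : MultiGraph (Fin 6) (Fin k)` is determined, up to the order and orientation
of its edges, by its **adjacency configuration** `adjCfg G : Config (Fin 15)` (one bit per pair
of vertices, `pairOf`). The 48 permutations of the vertices that preserve the marks `0, 1, 2, 3`
(`symOf`, each with its inverse) act on configurations by `pushCfg`. For a list `reps` of
representatives, `orbitUnion reps` is the bitmap of all adjacency codes in the orbits of the
representatives, and `censusLoop (censusCheck k (orbitUnion reps)) 32768 true = true` (one kernel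
check) says that every `k`-edge configuration in which the unmarked vertices `4, 5` have degree
`≥ 3` is in one of the orbits.

`C005CensusTransfer.lean` turns a passing loop into C-005 for every graph: the isomorphism behind
a configuration identity, then the transfer along it and along the permutation of the marks.
-/

namespace PercRepro

namespace MultiGraph

open Finset

/-! ### Pairs of vertices and the adjacency configuration -/

/-- The fifteen pairs of vertices of `Fin 6`, in lexicographic order. -/
def pairOf : Fin 15 → Fin 6 × Fin 6 :=
  fun q => (![0, 0, 0, 0, 0, 1, 1, 1, 1, 2, 2, 2, 3, 3, 4] q, ![1, 2, 3, 4, 5, 2, 3, 4, 5, 3, 4, 5, 4, 5, 5] q)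

/-- The index of the pair `{i, j}` (`0` on the diagonal, never used). -/
def pairIdx (i j : Fin 6) : Fin 15 :=
  ![![0, 0, 1, 2, 3, 4], ![0, 0, 5, 6, 7, 8], ![1, 5, 0, 9, 10, 11], ![2, 6, 9, 0, 12, 13],
    ![3, 7, 10, 12, 0, 14], ![4, 8, 11, 13, 14, 0]] i j

/-- `pairIdx` is symmetric. -/
theorem pairIdx_comm (i j : Fin 6) : pairIdx i j = pairIdx j i := by
  revert i j
  decide

/-- The pair of the index of a pair. -/
theorem pairOf_pairIdx (i j : Fin 6) (hij : i ≠ j) :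
    pairOf (pairIdx i j) = (i, j) ∨ pairOf (pairIdx i j) = (j, i) := by
  revert i j
  decide

/-- The index of a pair is determined by the pair. -/
theorem pairIdx_pairOf (q : Fin 15) : pairIdx (pairOf q).1 (pairOf q).2 = q := by
  revert q
  decide

/-- The two vertices of a pair are distinct. -/
theorem pairOf_ne (q : Fin 15) : (pairOf q).1 ≠ (pairOf q).2 := by
  revert q
  decide

variable {k : ℕ} (G : MultiGraph (Fin 6) (Fin k))

/-- The adjacency configuration of `G`: the pair `q` is set iff some edge of `G` joins its two
vertices. -/
def adjCfg : Config (Fin 15) := fun q =>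
  decide (∃ e, (G.fst e = (pairOf q).1 ∧ G.snd e = (pairOf q).2) ∨
    (G.fst e = (pairOf q).2 ∧ G.snd e = (pairOf q).1))

/-- Reading the adjacency configuration. -/
theorem adjCfg_eq_true_iff (q : Fin 15) : G.adjCfg q = true ↔
    ∃ e, (G.fst e = (pairOf q).1 ∧ G.snd e = (pairOf q).2) ∨
      (G.fst e = (pairOf q).2 ∧ G.snd e = (pairOf q).1) := by
  simp [adjCfg]

/-- The pair index of an edge. -/
def edgePair (e : Fin k) : Fin 15 := pairIdx (G.fst e) (G.snd e)

/-- The adjacency bit of the pair of an edge of a loopless graph is set. -/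
theorem adjCfg_edgePair (hG : ∀ e, G.fst e ≠ G.snd e) (e : Fin k) :
    G.adjCfg (G.edgePair e) = true := by
  rw [adjCfg_eq_true_iff]
  refine ⟨e, ?_⟩
  rcases pairOf_pairIdx (G.fst e) (G.snd e) (hG e) with h | h
  · rw [edgePair, h]
    exact Or.inl ⟨rfl, rfl⟩
  · rw [edgePair, h]
    exact Or.inr ⟨rfl, rfl⟩

/-- A set adjacency bit comes from an edge of `G` with that pair. -/
theorem exists_edgePair_of_adjCfg {q : Fin 15} (hq : G.adjCfg q = true) :
    ∃ e, G.edgePair e = q := by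
  rw [adjCfg_eq_true_iff] at hq
  obtain ⟨e, ⟨h1, h2⟩ | ⟨h1, h2⟩⟩ := hq
  · exact ⟨e, by rw [edgePair, h1, h2, pairIdx_pairOf]⟩
  · exact ⟨e, by rw [edgePair, h1, h2, pairIdx_comm, pairIdx_pairOf]⟩

/-- In a simple graph, the pair map of the edges is injective. -/
theorem edgePair_injective (hG : G.IsSimple) : Function.Injective G.edgePair := by
  intro e e' h
  apply hG.2
  unfold edgePair at h
  rcases pairOf_pairIdx (G.fst e) (G.snd e) (hG.1 e) with h1 | h1 <;>
    rcases pairOf_pairIdx (G.fst e') (G.snd e') (hG.1 e') with h2 | h2 <;>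
    rw [h] at h1 <;> rw [h1] at h2 <;> simp only [Prod.mk.injEq] at h2 <;>
    first
    | exact Or.inl ⟨h2.1, h2.2⟩
    | exact Or.inr ⟨h2.1, h2.2⟩
    | exact Or.inl ⟨h2.2, h2.1⟩
    | exact Or.inr ⟨h2.2, h2.1⟩

/-- The set bits of the adjacency configuration of a loopless graph are exactly the pairs of its
edges. -/
theorem filter_adjCfg_eq_image (hG : ∀ e, G.fst e ≠ G.snd e) :
    univ.filter (fun q => G.adjCfg q = true) = univ.image G.edgePair := by
  ext q
  simp only [mem_filter, mem_univ, true_and, mem_image]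
  constructor
  · intro hq
    obtain ⟨e, he⟩ := G.exists_edgePair_of_adjCfg hq
    exact ⟨e, he⟩
  · rintro ⟨e, rfl⟩
    exact G.adjCfg_edgePair hG e

/-! ### The number of set bits and the degrees of the unmarked vertices -/

/-- The number of pairs set in a configuration. -/
def popCfg (u : Config (Fin 15)) : ℕ := ∑ q : Fin 15, if u q then 1 else 0

/-- The degree of the vertex `v` in a configuration. -/
def degCfg (u : Config (Fin 15)) (v : Fin 6) : ℕ :=
  ∑ q : Fin 15, if u q ∧ ((pairOf q).1 = v ∨ (pairOf q).2 = v) then 1 else 0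

/-- `popCfg` counts the set bits. -/
theorem popCfg_eq_card (u : Config (Fin 15)) : popCfg u = (univ.filter fun q => u q = true).card := by
  rw [popCfg, card_eq_sum_ones, sum_filter]

/-- `degCfg` counts the set bits at `v`. -/
theorem degCfg_eq_card (u : Config (Fin 15)) (v : Fin 6) :
    degCfg u v = ((univ.filter fun q => u q = true).filter
      fun q => (pairOf q).1 = v ∨ (pairOf q).2 = v).card := by
  rw [degCfg, card_eq_sum_ones, sum_filter, sum_filter]
  refine Fintype.sum_congr _ _ fun q => ?_
  by_cases h1 : u q = true <;> by_cases h2 : (pairOf q).1 = v ∨ (pairOf q).2 = v <;> simp [h1, h2]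

/-- A simple graph with `k` edges has `k` set pairs. -/
theorem popCfg_adjCfg (hG : G.IsSimple) : popCfg G.adjCfg = k := by
  rw [popCfg_eq_card, G.filter_adjCfg_eq_image hG.1,
    card_image_of_injective _ (G.edgePair_injective hG)]
  simp

/-- The pair of an edge contains `v` iff the edge is incident to `v`. -/
theorem mem_pair_edgePair_iff (hG : ∀ e, G.fst e ≠ G.snd e) (e : Fin k) (v : Fin 6) :
    ((pairOf (G.edgePair e)).1 = v ∨ (pairOf (G.edgePair e)).2 = v) ↔
      (G.fst e = v ∨ G.snd e = v) := by
  rcases pairOf_pairIdx (G.fst e) (G.snd e) (hG e) with h | h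
  · rw [edgePair, h]
  · rw [edgePair, h]
    exact or_comm

/-- The degree of `v` in the adjacency configuration of a simple graph is its number of incident
edges. -/
theorem degCfg_adjCfg (hG : G.IsSimple) (v : Fin 6) :
    degCfg G.adjCfg v = (G.incidentEdges v).card := by
  rw [degCfg_eq_card, G.filter_adjCfg_eq_image hG.1, filter_image]
  rw [show (univ.filter fun e => (pairOf (G.edgePair e)).1 = v ∨ (pairOf (G.edgePair e)).2 = v) =
      G.incidentEdges v from ?_]
  · exact card_image_of_injective _ (G.edgePair_injective hG)
  · ext e
    simp only [mem_filter, mem_univ, true_and, incidentEdges]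
    exact G.mem_pair_edgePair_iff hG.1 e v

/-! ### The symmetry group and its action on configurations -/

/-- The 48 permutations of `Fin 6` that preserve the marks `{0, 1, 2, 3}`, each with its
inverse. -/
def symOf : Fin 48 → (Fin 6 → Fin 6) × (Fin 6 → Fin 6) := ![
  (![0, 1, 2, 3, 4, 5], ![0, 1, 2, 3, 4, 5]),
  (![0, 1, 2, 3, 5, 4], ![0, 1, 2, 3, 5, 4]),
  (![0, 1, 3, 2, 4, 5], ![0, 1, 3, 2, 4, 5]),
  (![0, 1, 3, 2, 5, 4], ![0, 1, 3, 2, 5, 4]),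
  (![0, 2, 1, 3, 4, 5], ![0, 2, 1, 3, 4, 5]),
  (![0, 2, 1, 3, 5, 4], ![0, 2, 1, 3, 5, 4]),
  (![0, 2, 3, 1, 4, 5], ![0, 3, 1, 2, 4, 5]),
  (![0, 2, 3, 1, 5, 4], ![0, 3, 1, 2, 5, 4]),
  (![0, 3, 1, 2, 4, 5], ![0, 2, 3, 1, 4, 5]),
  (![0, 3, 1, 2, 5, 4], ![0, 2, 3, 1, 5, 4]),
  (![0, 3, 2, 1, 4, 5], ![0, 3, 2, 1, 4, 5]),
  (![0, 3, 2, 1, 5, 4], ![0, 3, 2, 1, 5, 4]),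
  (![1, 0, 2, 3, 4, 5], ![1, 0, 2, 3, 4, 5]),
  (![1, 0, 2, 3, 5, 4], ![1, 0, 2, 3, 5, 4]),
  (![1, 0, 3, 2, 4, 5], ![1, 0, 3, 2, 4, 5]),
  (![1, 0, 3, 2, 5, 4], ![1, 0, 3, 2, 5, 4]),
  (![1, 2, 0, 3, 4, 5], ![2, 0, 1, 3, 4, 5]),
  (![1, 2, 0, 3, 5, 4], ![2, 0, 1, 3, 5, 4]),
  (![1, 2, 3, 0, 4, 5], ![3, 0, 1, 2, 4, 5]),
  (![1, 2, 3, 0, 5, 4], ![3, 0, 1, 2, 5, 4]),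
  (![1, 3, 0, 2, 4, 5], ![2, 0, 3, 1, 4, 5]),
  (![1, 3, 0, 2, 5, 4], ![2, 0, 3, 1, 5, 4]),
  (![1, 3, 2, 0, 4, 5], ![3, 0, 2, 1, 4, 5]),
  (![1, 3, 2, 0, 5, 4], ![3, 0, 2, 1, 5, 4]),
  (![2, 0, 1, 3, 4, 5], ![1, 2, 0, 3, 4, 5]),
  (![2, 0, 1, 3, 5, 4], ![1, 2, 0, 3, 5, 4]),
  (![2, 0, 3, 1, 4, 5], ![1, 3, 0, 2, 4, 5]),
  (![2, 0, 3, 1, 5, 4], ![1, 3, 0, 2, 5, 4]),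
  (![2, 1, 0, 3, 4, 5], ![2, 1, 0, 3, 4, 5]),
  (![2, 1, 0, 3, 5, 4], ![2, 1, 0, 3, 5, 4]),
  (![2, 1, 3, 0, 4, 5], ![3, 1, 0, 2, 4, 5]),
  (![2, 1, 3, 0, 5, 4], ![3, 1, 0, 2, 5, 4]),
  (![2, 3, 0, 1, 4, 5], ![2, 3, 0, 1, 4, 5]),
  (![2, 3, 0, 1, 5, 4], ![2, 3, 0, 1, 5, 4]),
  (![2, 3, 1, 0, 4, 5], ![3, 2, 0, 1, 4, 5]),
  (![2, 3, 1, 0, 5, 4], ![3, 2, 0, 1, 5, 4]),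
  (![3, 0, 1, 2, 4, 5], ![1, 2, 3, 0, 4, 5]),
  (![3, 0, 1, 2, 5, 4], ![1, 2, 3, 0, 5, 4]),
  (![3, 0, 2, 1, 4, 5], ![1, 3, 2, 0, 4, 5]),
  (![3, 0, 2, 1, 5, 4], ![1, 3, 2, 0, 5, 4]),
  (![3, 1, 0, 2, 4, 5], ![2, 1, 3, 0, 4, 5]),
  (![3, 1, 0, 2, 5, 4], ![2, 1, 3, 0, 5, 4]),
  (![3, 1, 2, 0, 4, 5], ![3, 1, 2, 0, 4, 5]),
  (![3, 1, 2, 0, 5, 4], ![3, 1, 2, 0, 5, 4]),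
  (![3, 2, 0, 1, 4, 5], ![2, 3, 1, 0, 4, 5]),
  (![3, 2, 0, 1, 5, 4], ![2, 3, 1, 0, 5, 4]),
  (![3, 2, 1, 0, 4, 5], ![3, 2, 1, 0, 4, 5]),
  (![3, 2, 1, 0, 5, 4], ![3, 2, 1, 0, 5, 4])]

set_option maxRecDepth 4000 in
/-- Each entry of `symOf` is a pair of mutually inverse maps preserving the marks. -/
theorem symOf_ok : ∀ k : Fin 48, (∀ i, (symOf k).2 ((symOf k).1 i) = i) ∧
    (∀ i, (symOf k).1 ((symOf k).2 i) = i) ∧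
    (∀ i : Fin 6, i.val < 4 → ((symOf k).1 i).val < 4) ∧
    (∀ i : Fin 6, i.val < 4 → ((symOf k).2 i).val < 4) := by
  decide +kernel

/-- The configuration of the relabelled graph: the pair `q = {a, b}` of the relabelled graph is set
iff the pair `{σ' a, σ' b}` of the original one is (`σ'` = the inverse relabelling). -/
def pushCfg (σ' : Fin 6 → Fin 6) (u : Config (Fin 15)) : Config (Fin 15) :=
  fun q => u (pairIdx (σ' (pairOf q).1) (σ' (pairOf q).2))

/-- The bitmap of the adjacency codes of the orbits of the representatives. -/
def orbitUnion (reps : List (MultiGraph (Fin 6) (Fin k))) : ℕ :=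
  ((reps.map fun H => encode H.adjCfg).flatMap fun a =>
      (List.finRange 48).map fun k => encode (pushCfg (symOf k).2 (cfgOf 15 a))).foldl
    (fun U a => U ||| (1 <<< a)) 0

/-- The number of set bits among the low `k` bits of `a`. -/
def popMask : ℕ → ℕ → ℕ
  | 0, _ => 0
  | k + 1, a => a % 2 + popMask k (a / 2)

/-- `popMask` counts the set bits. -/
theorem popMask_eq (k : ℕ) : ∀ a : ℕ, popMask k a = ∑ i : Fin k, if a.testBit i.val then 1 else 0 := by
  induction k with
  | zero => intro a; simp [popMask]
  | succ k ih =>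
    intro a
    rw [popMask, ih (a / 2), Fin.sum_univ_succ]
    congr 1
    · simp only [Fin.val_zero, Nat.testBit_zero]
      rcases Nat.mod_two_eq_zero_or_one a with h | h <;> simp [h]
    · refine Fintype.sum_congr _ _ fun i => ?_
      rw [Fin.val_succ, Nat.testBit_add_one]

/-- `popMask` of a code counts the set pairs of its configuration. -/
theorem popMask_encode (u : Config (Fin 15)) : popMask 15 (encode u) = popCfg u := by
  rw [popMask_eq, popCfg]
  refine Fintype.sum_congr _ _ fun q => ?_
  rw [testBit_encode u q.val q.isLt]

/-- The pairs at the vertex `4` (bits `3, 7, 10, 12, 14`). -/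
def vmask4 : ℕ := 21640

/-- The pairs at the vertex `5` (bits `4, 8, 11, 13, 14`). -/
def vmask5 : ℕ := 26896

/-- The bits of `vmask4` are the pairs at `4`. -/
theorem testBit_vmask4 : ∀ q : Fin 15,
    vmask4.testBit q.val = decide ((pairOf q).1 = 4 ∨ (pairOf q).2 = 4) := by
  decide

/-- The bits of `vmask5` are the pairs at `5`. -/
theorem testBit_vmask5 : ∀ q : Fin 15,
    vmask5.testBit q.val = decide ((pairOf q).1 = 5 ∨ (pairOf q).2 = 5) := by
  decide

/-- `popMask` of the code masked at `4` is the degree of `4`. -/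
theorem popMask_land_vmask4 (u : Config (Fin 15)) :
    popMask 15 (encode u &&& vmask4) = degCfg u 4 := by
  rw [popMask_eq, degCfg]
  refine Fintype.sum_congr _ _ fun q => ?_
  rw [Nat.testBit_land, testBit_encode u q.val q.isLt, testBit_vmask4]
  by_cases h1 : u q = true <;> by_cases h2 : (pairOf q).1 = 4 ∨ (pairOf q).2 = 4 <;> simp [h1, h2]

/-- `popMask` of the code masked at `5` is the degree of `5`. -/
theorem popMask_land_vmask5 (u : Config (Fin 15)) :
    popMask 15 (encode u &&& vmask5) = degCfg u 5 := by
  rw [popMask_eq, degCfg]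
  refine Fintype.sum_congr _ _ fun q => ?_
  rw [Nat.testBit_land, testBit_encode u q.val q.isLt, testBit_vmask5]
  by_cases h1 : u q = true <;> by_cases h2 : (pairOf q).1 = 5 ∨ (pairOf q).2 = 5 <;> simp [h1, h2]

/-- The per-code check: a `k`-edge code whose unmarked vertices have degree `≥ 3` must lie in the
orbit bitmap (bit arithmetic only, for the kernel). -/
def censusCheck (k : ℕ) (U : ℕ) (a : ℕ) : Bool :=
  (popMask 15 a != k) || (popMask 15 (a &&& vmask4) < 3) || (popMask 15 (a &&& vmask5) < 3) ||
    U.testBit a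

/-- The per-code check without the degree condition: EVERY `k`-edge code must lie in the orbit
bitmap. -/
def censusCheckAll (k : ℕ) (U : ℕ) (a : ℕ) : Bool := (popMask 15 a != k) || U.testBit a

/-- The loop of a per-code check over all codes below `n` (tail-recursive, the accumulator forced
at every step). -/
def censusLoop (chk : ℕ → Bool) : ℕ → Bool → Bool
  | 0, acc => acc
  | n + 1, acc => match acc with
    | false => false
    | true => censusLoop chk n (chk n)

/-- What the loop certifies. -/
theorem censusLoop_spec (chk : ℕ → Bool) : ∀ (n : ℕ) (acc : Bool), censusLoop chk n acc = true →
    acc = true ∧ ∀ a < n, chk a = true := by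
  intro n
  induction n with
  | zero => intro acc h; exact ⟨h, fun a ha => absurd ha (Nat.not_lt_zero a)⟩
  | succ n ih =>
    intro acc h
    cases acc with
    | false => exact absurd h (by simp [censusLoop])
    | true =>
      refine ⟨rfl, fun a ha => ?_⟩
      have h' := ih _ h
      rcases Nat.lt_succ_iff_lt_or_eq.1 ha with ha | rfl
      · exact h'.2 a ha
      · exact h'.1

/-- A set bit of the bitmap `foldl (· ||| 1 <<< ·)` is a member of the list (or of the start). -/
theorem testBit_foldl_lor (L : List ℕ) : ∀ (M a : ℕ),
    (L.foldl (fun U b => U ||| (1 <<< b)) M).testBit a = true → M.testBit a = true ∨ a ∈ L := by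
  induction L with
  | nil => intro M a h; exact Or.inl h
  | cons b L ih =>
    intro M a h
    simp only [List.foldl_cons] at h
    rcases ih _ _ h with h | h
    · rw [Nat.testBit_lor, Bool.or_eq_true, Nat.testBit_shiftLeft] at h
      rcases h with h | h
      · exact Or.inl h
      · right
        rw [Bool.and_eq_true, decide_eq_true_eq] at h
        have : a - b = 0 := by
          by_contra hne
          rw [Nat.testBit_one_eq_true_iff_self_eq_zero] at h
          omega
        have hab : a = b := by omega
        exact hab ▸ List.mem_cons_self
    · exact Or.inr (List.mem_cons_of_mem _ h)

/-- A set bit of the orbit bitmap is the code of a pushed representative. -/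
theorem exists_of_testBit_orbitUnion (reps : List (MultiGraph (Fin 6) (Fin k))) {a : ℕ}
    (h : (orbitUnion reps).testBit a = true) :
    ∃ H ∈ reps, ∃ k : Fin 48, encode (pushCfg (symOf k).2 H.adjCfg) = a := by
  rcases testBit_foldl_lor _ _ _ h with h | h
  · simp at h
  · simp only [List.mem_flatMap, List.mem_map, List.mem_finRange, true_and] at h
    obtain ⟨a, ⟨H, hH, rfl⟩, k, rfl⟩ := h
    exact ⟨H, hH, k, by rw [cfgOf_encode]⟩

end MultiGraph

end PercRepro
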